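import Summits.SmoothPoincare4.SmoothPoincare4.Theorems.SymplecticOrigamiFoldedSphereFoldExistencePfaffian
import Literature.Geometry.Kaehler.ManifoldFormsPullback
import Literature.Topology.FourManifolds.ClosedBallProofs

/-!
# Transport of folded symplectic forms along diffeomorphisms

Helper file for item `FoldedSphereFoldExistence` (route SymplecticOrigami): every clause of the
tree's `Literature.Geometry.Symplectic.IsFoldedForm` (Cannas da Silva–Guillemin–Pires 2010,
Def. 2.1: smooth, closed, embedded folding hypersurface = degeneracy locus, `ω ∧ ω ⋔ 0` via the
chart Pfaffian, maximal rank on the fold) is invariant under pulling back along a `C^∞`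
diffeomorphism `Φ : M ≃ₘ M'` (`isFoldedForm_transport`). The only non-formal clause is the
transversality of the chart Pfaffian: in the chart at `x₀` the representative of `Φ^*s` is the
pull-back of the representative of `s` along the transition map `g` of `Φ`, so its Pfaffian is
`det(Dg) · Pf(s-rep ∘ g)` (`pfaffian_compContinuousLinearMap`), whose derivative at the centre is
`det(Dg) · Pf(s-rep)' ∘ Dg ≠ 0` because `Pf(s-rep)` vanishes at a fold point
(`pfaffian_eq_zero_of_degenerate`).
-/

noncomputable section

-- the prescribed namespace `Summit.<P>.<Sub>.…` duplicates `SmoothPoincare4` (P = Sub)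
set_option linter.dupNamespace false

open scoped Manifold ContDiff Topology
open Set Function
open Literature.Geometry.Symplectic

namespace Summit.SmoothPoincare4.SmoothPoincare4.Theorems.FoldedSphereFoldExistence

/-! ## Transport of folded forms along diffeomorphisms -/

section Transport

open Literature.Geometry.Kaehler Filter

variable {M : Type*} [TopologicalSpace M] [ChartedSpace (EuclideanSpace ℝ (Fin 4)) M]
  {M' : Type*} [TopologicalSpace M'] [ChartedSpace (EuclideanSpace ℝ (Fin 4)) M']

/-- Evaluation of a pulled-back `2`-form on a pair of tangent vectors. [folklore] -/
theorem pullback_apply_two (f : M → M') (s : MForm (𝓡 4) M' ℝ 2) (x : M)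
    (v w : TangentSpace (𝓡 4) x) :
    s.pullback (𝓡 4) f x ![v, w] =
      s (f x) ![mfderiv (𝓡 4) (𝓡 4) f x v, mfderiv (𝓡 4) (𝓡 4) f x w] := by
  rw [MForm.pullback_apply]
  congr 1
  funext i
  fin_cases i <;> rfl

/-- A product lemma: if `D` is continuous at `x`, `Q` is differentiable at `x` with `Q x = 0`,
then `D · Q` is differentiable at `x` with derivative `D x • Q'`. [folklore] -/
theorem hasFDerivAt_mul_of_continuousAt_of_eq_zero {F : Type*} [NormedAddCommGroup F]
    [NormedSpace ℝ F] {D Q : F → ℝ} {Q' : F →L[ℝ] ℝ} {x : F} (hD : ContinuousAt D x)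
    (hQ : HasFDerivAt Q Q' x) (hQ0 : Q x = 0) :
    HasFDerivAt (fun y => D y * Q y) (D x • Q') x := by
  rw [hasFDerivAt_iff_isLittleO_nhds_zero] at hQ ⊢
  simp only [hQ0] at hQ
  -- `D(x+h) Q(x+h) - D x Q' h = D(x+h) (Q(x+h) - Q' h) + (D(x+h) - D x) Q' h`
  have hc : ContinuousAt (fun h => D (x + h)) 0 := by
    have : ContinuousAt D (x + 0) := by simpa using hD
    exact this.comp (continuousAt_const.add continuousAt_id)
  have h1 : (fun h => D (x + h) * (Q (x + h) - Q' h)) =o[𝓝 0] fun h => h := by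
    have hDb : (fun h => D (x + h)) =O[𝓝 0] fun _ => (1 : ℝ) :=
      hc.norm.isBoundedUnder_le.isBigO_one ℝ
    have hQn : (fun h => Q (x + h) - Q' h) =o[𝓝 0] fun h => ‖h‖ :=
      Asymptotics.isLittleO_norm_right.2 (by simpa using hQ)
    have h := hDb.mul_isLittleO hQn
    exact Asymptotics.isLittleO_norm_right.1 (by simpa using h)
  have h2 : (fun h => (D (x + h) - D x) * Q' h) =o[𝓝 0] fun h => h := by
    have hD0 : Tendsto (fun h => D (x + h) - D x) (𝓝 0) (𝓝 0) := by
      have := hc.tendsto.sub_const (D x)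
      simpa using this
    have hDo : (fun h => D (x + h) - D x) =o[𝓝 0] fun _ => (1 : ℝ) :=
      (Asymptotics.isLittleO_one_iff ℝ).2 hD0
    have hQ'O : (fun h => Q' h) =O[𝓝 0] fun h => ‖h‖ :=
      Asymptotics.isBigO_norm_right.2 (Q'.isBigO_id (𝓝 0))
    have h := hDo.mul_isBigO hQ'O
    exact Asymptotics.isLittleO_norm_right.1 (by simpa using h)
  have h3 := h1.add h2
  refine h3.congr' (Eventually.of_forall fun h => ?_) (Eventually.of_forall fun h => rfl)
  simp only [FunLike.coe_smul, Pi.smul_apply, smul_eq_mul, hQ0, mul_zero, sub_zero]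
  ring

/-- The fold of a form pulled back along a diffeomorphism is the preimage of the fold.
[folklore] -/
theorem fold_pullback_diffeomorph (Φ : M ≃ₘ⟮𝓡 4, 𝓡 4⟯ M') (s : MForm (𝓡 4) M' ℝ 2) :
    fold (s.pullback (𝓡 4) Φ) = Φ ⁻¹' fold s := by
  have hn : (∞ : ℕ∞ω) ≠ 0 := by simp
  ext x
  set L := Φ.mfderivToContinuousLinearEquiv hn x with hL_def
  have hL : ∀ u, L u = mfderiv (𝓡 4) (𝓡 4) Φ x u := fun u => rfl
  simp only [mem_preimage, mem_fold_iff, pullback_apply_two, ← hL]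
  constructor
  · rintro ⟨v, hv, hker⟩
    refine ⟨L v, fun h0 => hv (L.injective (h0.trans (map_zero L).symm)), fun w => ?_⟩
    have := hker (L.symm w)
    rwa [L.apply_symm_apply] at this
  · rintro ⟨v, hv, hker⟩
    refine ⟨L.symm v, fun h0 => hv ?_, fun w => ?_⟩
    · have := congrArg L h0
      rwa [L.apply_symm_apply, map_zero] at this
    · rw [L.apply_symm_apply]
      exact hker (L w)

variable [IsManifold (𝓡 4) ∞ M] [IsManifold (𝓡 4) ∞ M']

/-- The chart representative of a form at the centre of a chart at a fold point has vanishing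
Pfaffian (it is the degenerate form read through the invertible chart differential). [folklore] -/
theorem pfaffian_inChart_self_eq_zero (s : MForm (𝓡 4) M ℝ 2) {x : M} (hx : x ∈ fold s) :
    pfaffian (s.inChart x (extChartAt (𝓡 4) x x)) = 0 := by
  obtain ⟨v, hv, hker⟩ := hx
  have hc : extChartAt (𝓡 4) x x ∈ (extChartAt (𝓡 4) x).target := mem_extChartAt_target x
  obtain ⟨L, hL⟩ := isInvertible_mfderivWithin_extChartAt_symm (I := 𝓡 4) hc
  have hsymm : (extChartAt (𝓡 4) x).symm (extChartAt (𝓡 4) x x) = x := extChartAt_to_inv x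
  have hLw : ∀ u, mfderivWithin 𝓘(ℝ, EuclideanSpace ℝ (Fin 4)) (𝓡 4) (extChartAt (𝓡 4) x).symm (range (𝓡 4))
      (extChartAt (𝓡 4) x x) u = L u := fun u => by
    rw [← hL]
    rfl
  refine pfaffian_eq_zero_of_degenerate _ (v := L.symm v) ?_ fun w => ?_
  · intro h0
    exact hv ((L.apply_symm_apply v).symm.trans ((congrArg L h0).trans (map_zero L)))
  · rw [MForm.inChart_apply]
    have h2 : (fun i => mfderivWithin 𝓘(ℝ, EuclideanSpace ℝ (Fin 4)) (𝓡 4) (extChartAt (𝓡 4) x).symm (range (𝓡 4))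
        (extChartAt (𝓡 4) x x) ((![L.symm v, w] : Fin 2 → EuclideanSpace ℝ (Fin 4)) i)) = ![v, L w] := by
      funext i
      fin_cases i
      · exact (hLw (L.symm v)).trans (L.apply_symm_apply v)
      · exact hLw w
    rw [h2]
    -- `s` is read at `(extChartAt x).symm (extChartAt x x) = x`
    have key : ∀ (y : M) (hy : y = x) (u : EuclideanSpace ℝ (Fin 4)), s y ![v, u] = 0 := by
      intro y hy u
      subst hy
      exact hker u
    exact key _ hsymm (L w)

/-- **Transport of a folded symplectic form along a diffeomorphism.** If `Φ : M ≃ₘ M'` is a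
`C^∞` diffeomorphism and `s` is a folded form on `M'` with folding hypersurface `j : N ↪ M'`, then
`Φ^*s` is a folded form on `M` with folding hypersurface `Φ⁻¹ ∘ j`. (All clauses of Cannas da
Silva–Guillemin–Pires 2010, Def. 2.1 are diffeomorphism invariants; the chart Pfaffian of `Φ^*s`
at `x` is `det(Dg) · Pf(s-representative ∘ g)` for the transition map `g` of `Φ`.) [folklore] -/
theorem isFoldedForm_transport (Φ : M ≃ₘ⟮𝓡 4, 𝓡 4⟯ M') {s : MForm (𝓡 4) M' ℝ 2} {N : Type}
    [TopologicalSpace N] [ChartedSpace (EuclideanSpace ℝ (Fin 3)) N] {j : N → M'} (h : IsFoldedForm s N j) :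
    IsFoldedForm (s.pullback (𝓡 4) Φ) N (Φ.symm ∘ j) := by
  have hn : (∞ : ℕ∞ω) ≠ 0 := by simp
  have hΦ : ContMDiff (𝓡 4) (𝓡 4) ∞ Φ := Φ.contMDiff
  refine ⟨?_, ?_, ?_, ?_, ?_, ?_⟩
  · -- smooth
    exact Literature.NumberTheory.Transcendental.isSmoothForm_pullback hΦ h.smooth
  · -- closed
    show mextDeriv (s.pullback (𝓡 4) Φ) = 0
    rw [Literature.NumberTheory.Transcendental.mextDeriv_pullback hΦ h.smooth]
    have h0 : mextDeriv s = 0 := h.closed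
    rw [h0, MForm.pullback_zero]
  · -- embedding
    exact h.embedding.diffeomorph_comp Φ.symm
  · -- range
    rw [Set.range_comp, h.range_eq, Diffeomorph.symm_image_eq_preimage, fold_pullback_diffeomorph]
  · -- transverse
    intro x₀ hx₀
    have hx₀' : Φ x₀ ∈ fold s := by
      rw [fold_pullback_diffeomorph] at hx₀
      exact hx₀
    set c := extChartAt (𝓡 4) x₀ x₀ with hc_def
    set g : EuclideanSpace ℝ (Fin 4) → EuclideanSpace ℝ (Fin 4) := writtenInExtChartAt (𝓡 4) (𝓡 4) x₀ Φ with hg_def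
    set β := s.inChart (Φ x₀) with hβ_def
    have hgc : g c = extChartAt (𝓡 4) (Φ x₀) (Φ x₀) := writtenInExtChartAt_apply_self Φ x₀
    have hΦx : ContMDiffAt (𝓡 4) (𝓡 4) ∞ Φ x₀ := hΦ x₀
    have hgs : ContDiffAt ℝ ∞ g c := by
      have h1 : ContDiffWithinAt ℝ ∞ g (range (𝓡 4)) c := (contMDiffAt_iff.1 hΦx).2
      rw [ModelWithCorners.range_eq_univ] at h1
      exact h1.contDiffAt Filter.univ_mem
    -- the chart representative of `Φ^*s` near the centre
    have hev0 := s.inChart_pullback_eventuallyEq (I := 𝓡 4) (I' := 𝓡 4) (x := x₀)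
      (Eventually.of_forall fun z => (hΦ z).mdifferentiableAt hn)
    have hev : (fun y => pfaffian ((s.pullback (𝓡 4) Φ).inChart x₀ y)) =ᶠ[𝓝 c]
        fun y => LinearMap.det ((fderiv ℝ g y : (EuclideanSpace ℝ (Fin 4)) →L[ℝ] EuclideanSpace ℝ (Fin 4)) : (EuclideanSpace ℝ (Fin 4)) →ₗ[ℝ] EuclideanSpace ℝ (Fin 4)) *
          pfaffian (β (g y)) := by
      have hev1 : (s.pullback (𝓡 4) Φ).inChart x₀ =ᶠ[𝓝 c]
          fun y => (β (g y)).compContinuousLinearMap (fderiv ℝ g y) := by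
        have h2 := hev0
        rw [ModelWithCorners.range_eq_univ, nhdsWithin_univ] at h2
        filter_upwards [h2] with y hy
        rw [hy, fderivWithin_univ]
      filter_upwards [hev1] with y hy
      rw [hy, pfaffian_compContinuousLinearMap]
    rw [hev.fderiv_eq]
    -- the factor `Pf(β ∘ g)` vanishes at `c` and has derivative `Pf(β)' ∘ Dg`
    set P : EuclideanSpace ℝ (Fin 4) → ℝ := fun z => pfaffian (β z) with hP_def
    have hP' : fderiv ℝ P (g c) ≠ 0 := by
      rw [hgc]
      exact h.transverse (Φ x₀) hx₀'
    have hPd : DifferentiableAt ℝ P (g c) := by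
      by_contra hnd
      exact hP' (fderiv_zero_of_not_differentiableAt hnd)
    have hgd : DifferentiableAt ℝ g c := hgs.differentiableAt (by simp)
    have hQ : HasFDerivAt (fun y => P (g y)) ((fderiv ℝ P (g c)).comp (fderiv ℝ g c)) c :=
      hPd.hasFDerivAt.comp c hgd.hasFDerivAt
    have hQ0 : P (g c) = 0 := by
      simp only [hP_def, hβ_def, hgc]
      exact pfaffian_inChart_self_eq_zero s hx₀'
    -- the factor `det Dg` is continuous
    set D : EuclideanSpace ℝ (Fin 4) → ℝ := fun y =>
      LinearMap.det ((fderiv ℝ g y : (EuclideanSpace ℝ (Fin 4)) →L[ℝ] EuclideanSpace ℝ (Fin 4)) : (EuclideanSpace ℝ (Fin 4)) →ₗ[ℝ] EuclideanSpace ℝ (Fin 4)) with hD_def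
    have hDc : ContinuousAt D c := by
      have h1 : ContinuousAt (fun y => fderiv ℝ g y) c :=
        (hgs.fderiv_right (m := ∞) (by simp)).continuousAt
      exact (ContinuousLinearMap.continuous_det.continuousAt).comp h1
    have hG : HasFDerivAt (fun y => D y * P (g y))
        (D c • (fderiv ℝ P (g c)).comp (fderiv ℝ g c)) c :=
      hasFDerivAt_mul_of_continuousAt_of_eq_zero hDc hQ hQ0
    rw [hG.fderiv]
    -- `det Dg(c) ≠ 0` and `Dg(c)` is onto: `Dg(c) = dΦ_{x₀}` is invertible
    have hmf : mfderiv (𝓡 4) (𝓡 4) Φ x₀ = fderiv ℝ g c := by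
      rw [(hΦx.mdifferentiableAt hn).mfderiv, ModelWithCorners.range_eq_univ, fderivWithin_univ]
    set L := Φ.mfderivToContinuousLinearEquiv hn x₀ with hL_def
    have hL : (L : TangentSpace (𝓡 4) x₀ →L[ℝ] TangentSpace (𝓡 4) (Φ x₀)) = fderiv ℝ g c := by
      rw [← hmf]
      rfl
    have hLu : ∀ u, fderiv ℝ g c u = L u := fun u => by
      rw [← hL]
      rfl
    have hDc0 : D c ≠ 0 := by
      have hu := L.toLinearEquiv.isUnit_det'
      have h1 : LinearMap.det (L.toLinearEquiv : TangentSpace (𝓡 4) x₀ →ₗ[ℝ]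
          TangentSpace (𝓡 4) (Φ x₀)) = D c := by
        simp only [hD_def, ← hL]
        rfl
      rw [h1] at hu
      exact hu.ne_zero
    intro hzero
    rw [smul_eq_zero] at hzero
    rcases hzero with h0 | h0
    · exact hDc0 h0
    · apply hP'
      ext u
      have h1 := congrArg (fun T : (EuclideanSpace ℝ (Fin 4)) →L[ℝ] ℝ => T (L.symm u)) h0
      simp only [ContinuousLinearMap.comp_apply, hLu, ContinuousLinearEquiv.apply_symm_apply]
        at h1
      simpa using h1
  · -- maximal rank
    intro n
    have hΦx : Φ (Φ.symm (j n)) = j n := Φ.apply_symm_apply (j n)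
    set L := Φ.mfderivToContinuousLinearEquiv hn (Φ.symm (j n)) with hL_def
    have hL : ∀ u, L u = mfderiv (𝓡 4) (𝓡 4) Φ (Φ.symm (j n)) u := fun u => rfl
    -- the printed datum at `j n`, moved to the point `Φ (Φ⁻¹ (j n))`
    have hP : ∃ v : EuclideanSpace ℝ (Fin 4), (∀ w : EuclideanSpace ℝ (Fin 4), s (Φ (Φ.symm (j n))) ![v, w] = 0) ∧
        v ∉ range (mfderiv (𝓡 3) (𝓡 4) j n) := by
      rw [hΦx]
      exact h.maximalRank n
    obtain ⟨v, hker, hnot⟩ := hP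
    refine ⟨L.symm v, fun w => ?_, ?_⟩
    · show s.pullback (𝓡 4) Φ (Φ.symm (j n)) ![L.symm v, w] = 0
      rw [pullback_apply_two, ← hL, ← hL, L.apply_symm_apply]
      exact hker (L w)
    · rintro ⟨u, hu⟩
      apply hnot
      have hΦj : MDifferentiableAt (𝓡 3) (𝓡 4) (Φ.symm ∘ j) n :=
        ((Φ.symm.contMDiff.comp h.embedding.contMDiff) n).mdifferentiableAt hn
      have h1 := mfderiv_comp n (Φ.mdifferentiable hn ((Φ.symm ∘ j) n)) hΦj
      have h2 : ((⇑Φ) ∘ (⇑Φ.symm ∘ j) : N → M') = j := funext fun m => Φ.apply_symm_apply (j m)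
      rw [h2] at h1
      refine ⟨u, ?_⟩
      have h3 : mfderiv (𝓡 3) (𝓡 4) j n u = L (mfderiv (𝓡 3) (𝓡 4) (Φ.symm ∘ j) n u) :=
        congrArg (fun T => T u) h1
      exact h3.trans ((congrArg L hu).trans (L.apply_symm_apply v))

end Transport

end Summit.SmoothPoincare4.SmoothPoincare4.Theorems.FoldedSphereFoldExistence

end
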